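import Summits.QuantumFields.YangMills.Theorems.BalabanUVNodesN22JointChartsOfActivitySepHolo
import Summits.QuantumFields.YangMills.Theorems.BalabanUVNodesN22WindowedCouplingHoloOfLocalTermsRe

/-!
# BalabanUVNodes ∕ node N22 = NE9 — THE ANALYTIC ROAD's RECORD FACE IN ITS WEAKEST CURRENCY: SEPARATELY holomorphic, jointly continuous activity charts (Osgood,
# `…N22JointChartsOfActivitySepHolo`) AND NO reality binder (Schwarz reflection, `…N22WindowedCouplingHoloOfLocalTermsRe`) ⟹ K3 §2b's `h9` with the record's geometric moduli

WIDTH SEAT dag-n22-w1 (harness re-seat g5), piece C9 of its own lineage, part 2 — the COMBINED record face (part 1 `…N22JointChartsOfActivitySepHolo` = the Osgood edition with the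
reality binder; C8 `…N22WindowedCouplingHoloOfJointHoloRe` ∕ `…N22WindowedCouplingHoloOfLocalTermsRe` = the reality-binder removal).  Cell `pub-ymgap`, HUMAN RULING D-0062 (Track A) ∕
D-0149; `--kind proof --supports stmt-QuantumFields-27366 --as helper` (K3⁸ `SpineGivenEndpointR13SepCoPHV`, KEY MAP v2), COUNT-NEUTRAL.  THEOREMS ONLY (0 `def`, 0 `sorry`,
standard axioms).  Imports C9 part 1 and C8 part 2 only; two by-name compositions, nothing re-declared.

WHAT (all [folklore]).  ★★★ `ne9_EA_objectsOfRecord₁₃_of_kernelStepRate_activitySepChartsRe` — ROAD 3's record face in its WEAKEST activity currency: node N18's `KernelStepRateOfRecord₁₃`,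
the uniform decay, (1.21), W1-20's law, activity charts `ℋ K k h m X Z : ℂ × Ec K k → ℂ` that are holomorphic in the young coupling on `Dt` AT EACH complex probe field of the ball
and holomorphic in the field on the ball AT EACH coupling of `Dt` (SEPARATELY — [I] p. 263 ∕ §2 p. 266 and [II] p. 15 read on complex discs; joint continuity and then joint
holomorphy follow from the (2.38) bound by part 1's Osgood lemmas, `Ec K k` finite-dimensional), with (2.38) there, agreeing with the activities at real points; Road 1's
numerals; probe readings with the p. 282 tails; `Dt` CONJUGATION-SYMMETRIC containing the closed `r₀`-discs about `]0, θ.γ]` (NO reality of the terms at real data — C8);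
rows `δ₁ ≤ κ₅`, `δ₁ ≤ κd`, `κ ≤ r₁`, `2κ₀ ≤ κ`, `0 < s < 1`, `ℓ.θ₅^{1−s} ≤ ℓ.ω`, `ℓ.κ ≤ δ₁`, `C₉(s) ≤ ℓ.C₉` ⟹ `NE9 ((objectsOfRecord₁₃ F N θ ℓ).EA 0) (Window θ.γ) ℓ.κ ℓ.moduli`;
and its pin face `n22At_rateCarriers_of_kernels_pin_of_kernelStepRate_activitySepChartsRe` (`N22At (rateCarriersOfRecord₁₃CoPH 𝔯 F θ hP g₀ os k).u3`, every `k`).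

HONEST FRAMING (binding).  Hypothesis-form REDUCTION (count-neutral helper): N18's kernel step rate (NE5 NOT PRINTED for d = 4), the uniform decay, (1.21), W1-20's law, the
separately-holomorphic activity charts with (2.38) on complex discs (a LOCATED reading, NOT a printed display), Road 1's numerals, readings ∕ tails and the rows remain BINDERS
met by no object of record here; nothing of Bałaban's asserted or constructed ([I] = CMP 109 (1987) p. 263, (1.18)–(1.21) p. 264, §2 p. 266, p. 282; [II] = CMP 116 (1988)
(2.13)–(2.14) pp. 14–15, (2.38) p. 20 — TYPES only); N22 NOT discharged (typed 28∕28 · discharged 5∕27 UNCHANGED — the chair's single count line is the only count); K3⁸ OPEN,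
NOT claimed, no stub touched; one finite 𝕋⁴ programme at fixed ε — R4 closes the CONDITIONAL rung `BalabanLadder.UV` only; NOTHING about the continuum limit, ℝ⁴, OS axioms, a
mass gap or the Clay problem is proved or claimed by any of this.
-/

noncomputable section

open Filter Topology Set Metric
open scoped BigOperators ComplexConjugate

namespace YMDAG.N22.JointHoloLocalTerms

open Literature.MathematicalPhysics.QuantumFieldTheory.Balaban1983to89
open Literature.MathematicalPhysics.QuantumFieldTheory.Balaban1983to89.T4Continuum (T4Family ULoop)
open Literature.MathematicalPhysics.QuantumFieldTheory.Balaban1983to89.T4OutputRate (Window NE9 DecayBound)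
open Literature.MathematicalPhysics.QuantumFieldTheory.Balaban1983to89.TreeLengthTorus (TPt tsys torusTreeLen torusTreeLen_nonneg)
open Literature.MathematicalPhysics.QuantumFieldTheory.Balaban1983to89.TreeLengthTorusGeometry (TTouch)
open Literature.MathematicalPhysics.QuantumFieldTheory.Balaban1983to89.B12TreeDecay (K₀ kappa₀ K₀_pos)
open Literature.MathematicalPhysics.QuantumFieldTheory.Balaban1983to89.B12Decay510 (delta1)
open Literature.MathematicalPhysics.QuantumFieldTheory.Balaban1983to89.B12Decay510Window (K₁ K₁_nonneg)
open Literature.MathematicalPhysics.QuantumFieldTheory.Balaban1983to89.B12Decay510Torus (distCT nearT)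
open Literature.MathematicalPhysics.QuantumFieldTheory.Balaban1983to89.B13Resummation (locE locE_congr)
open Literature.MathematicalPhysics.QuantumFieldTheory.Balaban1983to89.Node00
open Literature.MathematicalPhysics.QuantumFieldTheory.Balaban1983to89.Node00.Sect2 (domSys domCount CPair)
open Literature.MathematicalPhysics.QuantumFieldTheory.Balaban1983to89.Node00.W1
open Literature.MathematicalPhysics.QuantumFieldTheory.Balaban1983to89.Node00.LocalizedSum17 (ReadingMaps Localizes17OfRecord₁₃)
open Literature.MathematicalPhysics.QuantumFieldTheory.Balaban1983to89.Node00.U3OfKernels (histPrefix objectsOfRecord₁₃)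
open Literature.MathematicalPhysics.QuantumFieldTheory.Balaban1983to89.Node00.U3KernelLetters (KernelStepRateOfRecord₁₃ PolLimitsExistOfRecord₁₃)
open YMDAG.UVSplit (N22At RateReading₁₃CoPH rateCarriersOfRecord₁₃CoPH)
open YMDAG.N22.AtKernels (n22At_rateCarriers_of_kernels_pin_of_ne9)

open scoped Matrix.Norms.L2Operator

/-! ## §3 AT THE RECORD: K3 §2b's `h9` on the analytic road from SEPARATELY holomorphic activity charts, WITHOUT the reality binder -/

section Record

variable (F : T4Family) (N : ℕ) [NeZero N] {𝔸 : Type*} {M : ℕ}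

open Classical in
/-- ★★★ **K3 §2b's `h9` WITH THE RECORD's GEOMETRIC MODULI ON THE ANALYTIC ROAD, FROM SEPARATELY HOLOMORPHIC ACTIVITY CHARTS, WITHOUT THE REALITY BINDER.**  As C6 §3
`ne9_EA_objectsOfRecord₁₃_of_kernelStepRate_activityJointCharts` with TWO binders WEAKENED and ONE REMOVED: the activity charts `ℋ` are asked to be SEPARATELY holomorphic (coupling at each
complex probe field, field at each coupling — Osgood with the (2.38) bound supplying continuity, `Ec K k` finite-dimensional) instead of jointly holomorphic, and the (2.13) terms of
record are NO LONGER asked to be REAL at real data (`hIm` gone; `Dt` conjugation-symmetric instead — every strip about the real window qualifies): N18's `KernelStepRateOfRecord₁₃`,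
the uniform decay, (1.21), W1-20's law, the separately-holomorphic activity charts with (2.38) on `Dt × ball(0,R)`, Road 1's numerals, probe readings with tails, rows ⟹
**`NE9 ((objectsOfRecord₁₃ F N θ ℓ).EA 0) (Window θ.γ) ℓ.κ ℓ.moduli`** (§2 + `…LocalTermsRe` §3).  THE N22 ROW SENTENCE, analytic road, weakest activity currency of the lineage:
«N18's kernel step rate + uniform decay + (1.21) + W1-20's law + activity charts analytic in each young coupling and in the field SEPARATELY, with (2.38) + Road 1's numerals + tails +
rows ⇒ `h9` with the record's geometric moduli».  LOCATED (hypothesis form); N22 NOT discharged. [folklore] -/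
theorem ne9_EA_objectsOfRecord₁₃_of_kernelStepRate_activitySepChartsRe (θ : Stage13Params F N) (ℓ : U3Letters₁₁) (hs : ℓ.Signs) (hγ : 0 < θ.γ)
    (hlim : PolLimitsExistOfRecord₁₃ F N θ) {κ₅ κd C₅ E₀ : ℝ} (hC₅ : 0 ≤ C₅) (hE₀ : 0 < E₀)
    (h5 : KernelStepRateOfRecord₁₃ F N θ κ₅ ℓ.θ₅ C₅) (hdec : DecayBound ((objectsOfRecord₁₃ F N θ ℓ).EA 0) (Window θ.γ) E₀ κd)
    (m' : ℕ) (M : ℕ) [NeZero M] (hM : M = F.L ^ m')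
    (S : (K : ℕ) → ClusterTower (F.P K) 𝔸 M) (emb : ReadingMaps F (MatA N) 𝔸) (hloc : Localizes17OfRecord₁₃ F N θ S emb)
    {κ δ₀ B₃ R r₀ s A Ra r₁ : ℝ} (hR : 0 < R) (hκ₀ : kappa₀ (4 * 2 ^ 4) (2 * 4) ≤ κ / 2) (hδ₀ : 0 < δ₀) (hB₃ : 0 ≤ B₃)
    (hA : 0 ≤ A) (hr₁ : 0 ≤ r₁) (hrate : r₁ + 2 * (64 * Real.log 162) + 2 ≤ Ra) (hsmall : A * Real.exp (5 * r₁ + 1) * K₀ 64 8 * 9 * 64 ≤ 1) (hκE : κ ≤ r₁)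
    (hr₀ : 0 < r₀) (hs0 : 0 < s) (hs1 : s < 1)
    (Ec : ℕ → ℕ → Type*) [∀ K k, NormedAddCommGroup (Ec K k)] [∀ K k, NormedSpace ℂ (Ec K k)] [∀ K k, FiniteDimensional ℂ (Ec K k)]
    (ι : letI := θ.instVβ₁; letI := θ.instVβ₂
      (K k : ℕ) → (domSys (F.P K) M (k + 1)).Dom → ((Fin (F.P K).d → Site (F.P K) (k + 1) → θ.Vβ) →L[ℝ] Ec K k))
    {Dt : Set ℂ} (hDt : IsOpen Dt) (hsymm : ∀ τ ∈ Dt, conj τ ∈ Dt) (hdisc : ∀ t ∈ Ioc (0 : ℝ) θ.γ, closedBall (t : ℂ) r₀ ⊆ Dt)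
    (ℋ : (K k : ℕ) → (ℕ → ℝ) → ℕ → (domSys (F.P K) M (k + 1)).Dom → (domSys (F.P K) M (k + 1)).Dom → ℂ × Ec K k → ℂ)
    (hℋτ : ∀ (K k : ℕ), ∀ h ∈ Window θ.γ, ∀ (m : ℕ) (X Z : (domSys (F.P K) M (k + 1)).Dom), Z.1 ⊆ X.1 → ∀ v ∈ ball (0 : Ec K k) R,
      DifferentiableOn ℂ (fun τ => ℋ K k h m X Z (τ, v)) Dt)
    (hℋv : ∀ (K k : ℕ), ∀ h ∈ Window θ.γ, ∀ (m : ℕ) (X Z : (domSys (F.P K) M (k + 1)).Dom), Z.1 ⊆ X.1 → ∀ τ ∈ Dt,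
      DifferentiableOn ℂ (fun v => ℋ K k h m X Z (τ, v)) (ball (0 : Ec K k) R))
    (hMℋ : ∀ (K k : ℕ), ∀ h ∈ Window θ.γ, ∀ (m : ℕ) (X Z : (domSys (F.P K) M (k + 1)).Dom), Z.1 ⊆ X.1 → ∀ p ∈ Dt ×ˢ ball (0 : Ec K k) R,
      ‖ℋ K k h m X Z p‖ ≤ A * Real.exp (-(Ra * (domSys (F.P K) M (k + 1)).dj Z)))
    (hfℋ : letI := θ.instVβ₁; letI := θ.instVβ₂
      ∀ (K k : ℕ), ∀ h ∈ Window θ.γ, ∀ (m : ℕ) (X Z : (domSys (F.P K) M (k + 1)).Dom), Z.1 ⊆ X.1 → ∀ t ∈ Ioc (0 : ℝ) θ.γ,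
        ∀ Bf : Fin (F.P K).d → Site (F.P K) (k + 1) → θ.Vβ,
          ℋ K k h m X Z (t, ι K k X Bf) = ((S K) k).H (histPrefix (Function.update h m t) k) (emb K k (fun l u => NormedSpace.exp (θ.ρ8 (Bf l u)))) Z)
    (w : (K k : ℕ) → (domSys (F.P K) M (k + 1)).Dom → Site (F.P K) (k + 1) → ℝ) (hw₀ : ∀ K k X t, 0 ≤ w K k X t)
    (hw : letI := θ.instVβ₁; letI := θ.instVβ₂; letI := θ.instιβ
      ∀ (K k : ℕ) (X : (domSys (F.P K) M (k + 1)).Dom) (l : Fin (F.P K).d) (t : Site (F.P K) (k + 1)) (c : θ.ιβ),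
        ‖ι K k X (Pi.single l (Pi.single t (θ.bV c)))‖ ≤ w K k X t)
    (htail : ∀ (K k : ℕ) (X : (domSys (F.P K) M (k + 1)).Dom) (t : Site (F.P K) (k + 1)),
      let e : Site (F.P K) (k + 1) → TPt 4 (domCount (F.P K) M (k + 1) * M) := fun x i => (ZMod.cast (x i) : ZMod (domCount (F.P K) M (k + 1) * M))
      w K k X t ≤ B₃ * Real.exp (-δ₀ * distCT (domCount (F.P K) M (k + 1)) M (e t) (nearT (M := M) (e t) X)))
    (hκ₅ : delta1 δ₀ κ ((M : ℝ) * 4) ≤ κ₅) (hκd : delta1 δ₀ κ ((M : ℝ) * 4) ≤ κd)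
    (hτω : ℓ.θ₅ ^ (1 - s) ≤ ℓ.ω) (hℓκ : ℓ.κ ≤ delta1 δ₀ κ ((M : ℝ) * 4))
    (hC₉ : 32 / (s ^ 2 * min (r₀ / 2) (θ.γ / 2)) * ((2 * (2 * C₅ / (1 - ℓ.θ₅) + 2 * E₀)) ^ (1 - s) *
        (2 * ((16 * (Real.exp 1 * 9 * 64 * K₀ 64 8 ^ 2 * A) * B₃ ^ 2 / R ^ 2) * Real.exp (delta1 δ₀ κ ((M : ℝ) * 4) * ((M : ℝ) * 4) * 3) * K₀ (4 * 2 ^ 4) (2 * 4) * K₁ 4 (δ₀ / 2) +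
          (2 * C₅ / (1 - ℓ.θ₅) + 2 * E₀))) ^ s) / ℓ.θ₅ ^ (1 - s) ≤ ℓ.C₉) :
    NE9 ((objectsOfRecord₁₃ F N θ ℓ).EA 0) (Window θ.γ) ℓ.κ ℓ.moduli := by
  letI := θ.instVβ₁; letI := θ.instVβ₂; letI := θ.instιβ
  have hB : (0 : ℝ) ≤ Real.exp 1 * 9 * 64 * K₀ 64 8 ^ 2 * A := by have := K₀_pos 64 8; positivity
  obtain ⟨h𝒢, hM𝒢, hf⟩ := jointCharts_of_activitySepCharts F S emb θ.ρ8 hA hr₁ hrate hsmall Ec ι hDt ℋ hℋτ hℋv hMℋ hfℋ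
  exact ne9_EA_objectsOfRecord₁₃_of_kernelStepRate_jointChartsRe F N θ ℓ hs hγ hlim hC₅ hE₀ h5 hdec m' M hM S emb hloc hR hκ₀ hδ₀ hB₃ hB hκE hr₀ hs0 hs1 Ec ι hDt hsymm
    hdisc (fun K k h m X p => locE (TTouch (d := 4) (N := domCount (F.P K) M (k + 1))) (fun Z : (domSys (F.P K) M (k + 1)).Dom => Z.1) (fun Z => ℋ K k h m X Z p) X.1)
    h𝒢 hM𝒢 hf w hw₀ hw htail hκ₅ hκd hτω hℓκ hC₉

open Classical in
/-- ★★★ **PIN FACE — THE N22 ROW OF K3⁸ ON THE ANALYTIC ROAD FROM SEPARATELY HOLOMORPHIC ACTIVITY CHARTS, WITHOUT THE REALITY BINDER**: `N22At (rateCarriersOfRecord₁₃CoPH 𝔯 F θ hP g₀ os k).u3`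
for every `k` under the node-U3 pin `hpin` — §3 composed with dag-n22-w3's `n22At_rateCarriers_of_kernels_pin_of_ne9`.  LOCATED; N22 NOT discharged; nothing of [I]∕[II] asserted.
[folklore] -/
theorem n22At_rateCarriers_of_kernels_pin_of_kernelStepRate_activitySepChartsRe (𝔯 : RateReading₁₃CoPH N) (θ : Stage13HParams F N) (hP : θ.Provisos₁₃CoPH F N)
    (g₀ : ℕ → ℝ) (os : List (ULoop F)) (ℓ : U3Letters₁₁) (hs : ℓ.Signs) (hγ : 0 < θ.γ)
    (hpin : (𝔯.lit F θ hP g₀ os).u3 = objectsOfRecord₁₃ F N θ.toStage13Params ℓ)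
    (hlim : PolLimitsExistOfRecord₁₃ F N θ.toStage13Params) {κ₅ κd C₅ E₀ : ℝ} (hC₅ : 0 ≤ C₅) (hE₀ : 0 < E₀)
    (h5 : KernelStepRateOfRecord₁₃ F N θ.toStage13Params κ₅ ℓ.θ₅ C₅) (hdec : DecayBound ((objectsOfRecord₁₃ F N θ.toStage13Params ℓ).EA 0) (Window θ.γ) E₀ κd)
    (m' : ℕ) (M : ℕ) [NeZero M] (hM : M = F.L ^ m')
    (S : (K : ℕ) → ClusterTower (F.P K) 𝔸 M) (emb : ReadingMaps F (MatA N) 𝔸) (hloc : Localizes17OfRecord₁₃ F N θ.toStage13Params S emb)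
    {κ δ₀ B₃ R r₀ s A Ra r₁ : ℝ} (hR : 0 < R) (hκ₀ : kappa₀ (4 * 2 ^ 4) (2 * 4) ≤ κ / 2) (hδ₀ : 0 < δ₀) (hB₃ : 0 ≤ B₃)
    (hA : 0 ≤ A) (hr₁ : 0 ≤ r₁) (hrate : r₁ + 2 * (64 * Real.log 162) + 2 ≤ Ra) (hsmall : A * Real.exp (5 * r₁ + 1) * K₀ 64 8 * 9 * 64 ≤ 1) (hκE : κ ≤ r₁)
    (hr₀ : 0 < r₀) (hs0 : 0 < s) (hs1 : s < 1)
    (Ec : ℕ → ℕ → Type*) [∀ K k, NormedAddCommGroup (Ec K k)] [∀ K k, NormedSpace ℂ (Ec K k)] [∀ K k, FiniteDimensional ℂ (Ec K k)]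
    (ι : letI := θ.instVβ₁; letI := θ.instVβ₂
      (K k : ℕ) → (domSys (F.P K) M (k + 1)).Dom → ((Fin (F.P K).d → Site (F.P K) (k + 1) → θ.Vβ) →L[ℝ] Ec K k))
    {Dt : Set ℂ} (hDt : IsOpen Dt) (hsymm : ∀ τ ∈ Dt, conj τ ∈ Dt) (hdisc : ∀ t ∈ Ioc (0 : ℝ) θ.γ, closedBall (t : ℂ) r₀ ⊆ Dt)
    (ℋ : (K k : ℕ) → (ℕ → ℝ) → ℕ → (domSys (F.P K) M (k + 1)).Dom → (domSys (F.P K) M (k + 1)).Dom → ℂ × Ec K k → ℂ)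
    (hℋτ : ∀ (K k : ℕ), ∀ h ∈ Window θ.γ, ∀ (m : ℕ) (X Z : (domSys (F.P K) M (k + 1)).Dom), Z.1 ⊆ X.1 → ∀ v ∈ ball (0 : Ec K k) R,
      DifferentiableOn ℂ (fun τ => ℋ K k h m X Z (τ, v)) Dt)
    (hℋv : ∀ (K k : ℕ), ∀ h ∈ Window θ.γ, ∀ (m : ℕ) (X Z : (domSys (F.P K) M (k + 1)).Dom), Z.1 ⊆ X.1 → ∀ τ ∈ Dt,
      DifferentiableOn ℂ (fun v => ℋ K k h m X Z (τ, v)) (ball (0 : Ec K k) R))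
    (hMℋ : ∀ (K k : ℕ), ∀ h ∈ Window θ.γ, ∀ (m : ℕ) (X Z : (domSys (F.P K) M (k + 1)).Dom), Z.1 ⊆ X.1 → ∀ p ∈ Dt ×ˢ ball (0 : Ec K k) R,
      ‖ℋ K k h m X Z p‖ ≤ A * Real.exp (-(Ra * (domSys (F.P K) M (k + 1)).dj Z)))
    (hfℋ : letI := θ.instVβ₁; letI := θ.instVβ₂
      ∀ (K k : ℕ), ∀ h ∈ Window θ.γ, ∀ (m : ℕ) (X Z : (domSys (F.P K) M (k + 1)).Dom), Z.1 ⊆ X.1 → ∀ t ∈ Ioc (0 : ℝ) θ.γ,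
        ∀ Bf : Fin (F.P K).d → Site (F.P K) (k + 1) → θ.Vβ,
          ℋ K k h m X Z (t, ι K k X Bf) = ((S K) k).H (histPrefix (Function.update h m t) k) (emb K k (fun l u => NormedSpace.exp (θ.ρ8 (Bf l u)))) Z)
    (w : (K k : ℕ) → (domSys (F.P K) M (k + 1)).Dom → Site (F.P K) (k + 1) → ℝ) (hw₀ : ∀ K k X t, 0 ≤ w K k X t)
    (hw : letI := θ.instVβ₁; letI := θ.instVβ₂; letI := θ.instιβ
      ∀ (K k : ℕ) (X : (domSys (F.P K) M (k + 1)).Dom) (l : Fin (F.P K).d) (t : Site (F.P K) (k + 1)) (c : θ.ιβ),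
        ‖ι K k X (Pi.single l (Pi.single t (θ.bV c)))‖ ≤ w K k X t)
    (htail : ∀ (K k : ℕ) (X : (domSys (F.P K) M (k + 1)).Dom) (t : Site (F.P K) (k + 1)),
      let e : Site (F.P K) (k + 1) → TPt 4 (domCount (F.P K) M (k + 1) * M) := fun x i => (ZMod.cast (x i) : ZMod (domCount (F.P K) M (k + 1) * M))
      w K k X t ≤ B₃ * Real.exp (-δ₀ * distCT (domCount (F.P K) M (k + 1)) M (e t) (nearT (M := M) (e t) X)))
    (hκ₅ : delta1 δ₀ κ ((M : ℝ) * 4) ≤ κ₅) (hκd : delta1 δ₀ κ ((M : ℝ) * 4) ≤ κd)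
    (hτω : ℓ.θ₅ ^ (1 - s) ≤ ℓ.ω) (hℓκ : ℓ.κ ≤ delta1 δ₀ κ ((M : ℝ) * 4))
    (hC₉ : 32 / (s ^ 2 * min (r₀ / 2) (θ.γ / 2)) * ((2 * (2 * C₅ / (1 - ℓ.θ₅) + 2 * E₀)) ^ (1 - s) *
        (2 * ((16 * (Real.exp 1 * 9 * 64 * K₀ 64 8 ^ 2 * A) * B₃ ^ 2 / R ^ 2) * Real.exp (delta1 δ₀ κ ((M : ℝ) * 4) * ((M : ℝ) * 4) * 3) * K₀ (4 * 2 ^ 4) (2 * 4) * K₁ 4 (δ₀ / 2) +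
          (2 * C₅ / (1 - ℓ.θ₅) + 2 * E₀))) ^ s) / ℓ.θ₅ ^ (1 - s) ≤ ℓ.C₉)
    (k : ℕ) :
    N22At (rateCarriersOfRecord₁₃CoPH 𝔯 F θ hP g₀ os k).u3 :=
  n22At_rateCarriers_of_kernels_pin_of_ne9 𝔯 θ hP g₀ os ℓ hs hpin
    (ne9_EA_objectsOfRecord₁₃_of_kernelStepRate_activitySepChartsRe F N θ.toStage13Params ℓ hs hγ hlim hC₅ hE₀ h5 hdec m' M hM S emb hloc hR hκ₀ hδ₀ hB₃ hA hr₁ hrate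
      hsmall hκE hr₀ hs0 hs1 Ec ι hDt hsymm hdisc ℋ hℋτ hℋv hMℋ hfℋ w hw₀ hw htail hκ₅ hκd hτω hℓκ hC₉) k

end Record

end YMDAG.N22.JointHoloLocalTerms

end
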